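import Summits.BirchSwinnertonDyer.BirchSwinnertonDyer.Theses.TameQuarticManinParity
import HarnessLib

/-!
# Route `TameQuarticManinParity` — the ASSEMBLY item (stmt-BirchSwinnertonDyer-23740) closed by name

HONEST FRAMING. This file proves the route's assembly decl
`Summit.BirchSwinnertonDyer.BirchSwinnertonDyer.Theses.TameQuarticManinParity.Assembly`, i.e. the pure
bookkeeping implication
`PublishedInputGZK → TprimeIrreducibleManinUnit → TprimeReducibleManinUnit → TprimeHeegnerUpperOfManinUnit →
TprimeRankOneLowerAtThree → Summit.BirchSwinnertonDyer.WAllExclAddTprimeAtThreeRankOne`, by the route file's own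
kernel-checked deciding theorem `closes` (planner-authored, D-0027 §2.1). The four cruxes (the two Manin
`3`-units, the Heegner upper half given them, the rank-one lower half at `3`) and the published input GZK remain
HYPOTHESES of the implication: nothing here is progress on them, and BSD is not proved by any of this.
-/

-- D-0017: single-problem summit, so `Summit.BirchSwinnertonDyer.BirchSwinnertonDyer.…` repeats a namespace BY DESIGN.
set_option linter.dupNamespace false

namespace Summit.BirchSwinnertonDyer.BirchSwinnertonDyer.Theorems.TameQuarticManinParity

/-- **The assembly of route `TameQuarticManinParity`** (item stmt-BirchSwinnertonDyer-23740): the published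
input `PublishedInputGZK` (Gross–Zagier–Kolyvagin, by name) and the four cruxes `TprimeIrreducibleManinUnit`,
`TprimeReducibleManinUnit`, `TprimeHeegnerUpperOfManinUnit`, `TprimeRankOneLowerAtThree` imply the registered
W-ALL leaf `Summit.BirchSwinnertonDyer.WAllExclAddTprimeAtThreeRankOne` ((t′) at `3`, analytic rank one). This is
literally the route's deciding theorem `Theses.TameQuarticManinParity.closes` (crux 4 fed with cruxes 2 and 3 gives
the typed UPPER half `Typed.MissingUpperBoundAt E 3`, crux 5 the LOWER half, `Typed.missingPPartAt_of_lower_of_upper`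
joins them and `Typed.bsdp_of_missingPPartAt` with GZK and `r_an = 1 ≤ 1` concludes `BSDp E 3`).
[father route-BirchSwinnertonDyer-TameQuarticManinParity, deciding theorem `closes`] -/
theorem assembly_proof :
    Summit.BirchSwinnertonDyer.BirchSwinnertonDyer.Theses.TameQuarticManinParity.Assembly := by
  unfold Summit.BirchSwinnertonDyer.BirchSwinnertonDyer.Theses.TameQuarticManinParity.Assembly
  intro hP h₂ h₃ h₄ h₅
  exact Summit.BirchSwinnertonDyer.BirchSwinnertonDyer.Theses.TameQuarticManinParity.closes hP h₂ h₃ h₄ h₅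

end Summit.BirchSwinnertonDyer.BirchSwinnertonDyer.Theorems.TameQuarticManinParity
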